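import Literature.Computability.AlgebraicComplexity.PermutationCommutant
import Literature.Computability.AlgebraicComplexity.EntropyMajorisation
import Literature.RepresentationTheory.GeneralLinear.WordModelIsotypicSpan
import Literature.RepresentationTheory.FiniteGroups.WordIsotypicProjectors
import HarnessLib

/-!
# Isotypic components of low-entropy shapes lie in the commutant span of low-entropy words

Topic `Literature/Computability/AlgebraicComplexity`; representation-theoretic input for an
elementary proof of Christandl–Vrana–Zuiddam, *Universal points in the asymptotic spectrum of
tensors*, J. Amer. Math. Soc. 36 (2023) = arXiv:1709.07851v3, **Thm. 3.24** (`E^θ(t) ≥ E_θ(t)`: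
the upper quantum functional of Def. 3.3 dominates the lower one of Def. 3.16), whose printed proof
rests on Keyl–Werner spectrum estimation (Thm. 3.27 / Cor. 3.28: the isotypic components `P_λ` of
`(ℂ^N)^{⊗n}` met by `ρ^{⊗n}` have `λ/n ≈ spec ρ`). In this tree the single-system estimate is the
sibling theorem `trace_proj_powMat_le` (`SpectrumSupportEstimate.lean`): the weight of `ρ^{⊗n}` on the
*commutant span* `𝒲(L)` (`PermutationCommutant.lean`) of a set `L` of at most
`poly(n) · 2^{n(H(spec ρ) - ε)}` words is eventually negligible. This file supplies the link between
the two languages, in the word model `Word N n → ℂ` of `(ℂ^N)^{⊗n}` (`TensorWordModel.lean`):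

* `wordIsotypicMatrix_mulVec_mem_commutantSpan` — **the `λ`-isotypic component
  `P_λ (ℂ^N)^{⊗n}` is contained in `𝒲(T_λ)`**, `T_λ` the words of content `λ` (any finite set of
  words containing them). Proof: by the span form of Schur–Weyl duality proved in the tree
  (`range_isotypicProj_wordPermRep`, `WordModelIsotypicSpan.lean`) the component is spanned by the
  translates `g^{⊗n} ξ` of highest-weight vectors `ξ` of weight `λ`; such `ξ` are supported on words
  of content `λ` (`apply_eq_zero_of_mem_highestWeightSpace`, `TensorWordModel.lean`), and every column
  `g^{⊗n} e_w` of a Kronecker power lies in `𝒲({w})` (`IsPermInvariant.col_mem_commutantSpan`).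
* `shannonEntropy_letterCount_eq_partitionEntropy` — a word of content `λ` has empirical entropy
  `H(λ̄)`; hence (`wordIsotypicMatrix_mulVec_mem_commutantSpan_entropy`) `P_λ (ℂ^N)^{⊗n} ⊆ 𝒲(L_h)` for
  the set `L_h` of words of empirical entropy `≤ h` whenever `H(λ̄) ≤ h`.
* Sums `Q_B = ∑_{λ ∈ B} P_λ` over a set `B` of shapes: Hermitian idempotents
  (`isHermitian_sum_wordIsotypicMatrix`, `sum_wordIsotypicMatrix_mul_sum_self`), complementary sums
  (`sum_wordIsotypicMatrix_add_sum_compl`), and `Q_B (ℂ^N)^{⊗n} ⊆ 𝒲(L_h)` when every `λ ∈ B` has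
  `H(λ̄) ≤ h` (`sum_wordIsotypicMatrix_mulVec_mem_commutantSpan_entropy`).

In the language of the source this is the (elementary half of the) statement "the range of `P_λ` is
`S_λ(V) ⊗ [λ]`, generated over `GL(V)` by weight-`λ` vectors" combined with the counting of CVZ
Rem. 3.7; no dimension formula and no character value is used. Theorems only: no definitions, no
named facts.

## References

* M. Christandl, P. Vrana, J. Zuiddam, J. Amer. Math. Soc. 36 (2023) 31–79 = arXiv:1709.07851v3,
  §3.1 (Schur–Weyl duality (sw), the projectors `P_λ^V`), Thm. 3.24, Thm. 3.27, Rem. 3.33.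
  [ChristandlVranaZuiddam2023]
* W. Fulton, J. Harris, *Representation Theory*, GTM 129, Thm. 6.3, §15.5. [FultonHarrisGTM129]
-/

noncomputable section

open scoped BigOperators Matrix

namespace Literature.Computability.AlgebraicComplexity

open Literature.NumberTheory.DiophantineGeometry (Word wordRep wordRep_apply wordPermRep
  tensorPowerMatrix spechtCharacter highestWeightSpace Weight apply_eq_zero_of_mem_highestWeightSpace)
open Literature.RepresentationTheory.FiniteGroups (wordIsotypicMatrix wordIsotypicMatrix_mulVec
  wordIsotypicProj isotypicProj conjTranspose_wordIsotypicMatrix wordIsotypicMatrix_mul_self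
  wordIsotypicMatrix_mul_of_ne sum_wordIsotypicMatrix)
open Literature.RepresentationTheory.GeneralLinear (range_isotypicProj_wordPermRep
  isotypicProj_wordPermRep_eq_zero_of_lt)

/-! ## Monotonicity of the commutant span and the tensor-power matrix -/

section General

variable {ι ι' : Type*} [DecidableEq ι] [DecidableEq ι'] [Fintype ι] [Fintype ι'] {n : ℕ}

/-- `𝒲(L)` is monotone in the set of words `L`. [folklore] -/
theorem commutantSpan_mono {L L' : Finset (Fin n → ι)} (h : L ⊆ L') :
    commutantSpan ι' L ≤ commutantSpan ι' L' := by
  refine Submodule.span_mono (Finset.coe_subset.2 (Finset.image_subset_image ?_))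
  exact Finset.product_subset_product_right h

/-- A vector supported on `L` whose image under a permutation-invariant matrix is taken lies in
`𝒲(L)`: `T v = ∑_{w ∈ supp v} v(w) · T e_w`. [folklore] -/
theorem IsPermInvariant.mulVec_mem_commutantSpan_of_support
    {T : Matrix (Fin n → ι') (Fin n → ι) ℂ} (hT : IsPermInvariant T) {L : Finset (Fin n → ι)}
    {v : (Fin n → ι) → ℂ} (hv : ∀ w, w ∉ L → v w = 0) : T *ᵥ v ∈ commutantSpan ι' L := by
  have hexp : T *ᵥ v = ∑ w, v w • fun w' => T w' w := by
    funext w'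
    simp only [Matrix.mulVec, dotProduct, Finset.sum_apply, Pi.smul_apply, smul_eq_mul]
    exact Finset.sum_congr rfl fun w _ => mul_comm _ _
  rw [hexp]
  refine Submodule.sum_mem _ fun w _ => ?_
  by_cases hw : w ∈ L
  · exact Submodule.smul_mem _ _ (hT.col_mem_commutantSpan hw)
  · rw [hv w hw, zero_smul]
    exact Submodule.zero_mem _

end General

/-! ## The isotypic components in the commutant span -/

section Isotypic

variable {N n : ℕ}

/-- The tree's two Kronecker powers of a square matrix on words agree definitionally:
`tensorPowerMatrix ℂ N n A = powMat A n`. [folklore] -/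
theorem tensorPowerMatrix_eq_powMat (A : Matrix (Fin N) (Fin N) ℂ) :
    tensorPowerMatrix ℂ N n A = powMat A n := rfl

/-- `g ∈ GL_N` acts on the word model by the permutation-invariant matrix `g^{⊗n}`:
`g · v = g^{⊗n} v`. [folklore] -/
theorem wordRep_eq_powMat_mulVec (g : GL (Fin N) ℂ) (v : Word N n → ℂ) :
    wordRep ℂ N n g v = powMat (g : Matrix (Fin N) (Fin N) ℂ) n *ᵥ v := by
  funext w'
  rw [wordRep_apply]
  simp only [Matrix.mulVec, dotProduct, powMat_apply]

/-- **Highest-weight vectors of weight `λ` live on the words of content `λ`**: a vector of the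
highest-weight space `HW_λ` of the word model vanishes at every word whose letter counts are not the
(zero-padded, decreasingly sorted) parts of `λ` (weight vectors are supported on words of the right
content, `TensorWordModel`). [cite: FultonHarrisGTM129, §15.5] -/
theorem apply_eq_zero_of_mem_highestWeightSpace_ofPartition {lam : Nat.Partition n}
    {ξ : Word N n → ℂ} (hξ : ξ ∈ highestWeightSpace (wordRep ℂ N n) (Weight.ofPartition N lam))
    {w : Word N n} (hw : ¬ ∀ i, letterCount w i = lam.sortedParts.getD i 0) : ξ w = 0 := by
  obtain ⟨i, hi⟩ := not_forall.1 hw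
  have hne : ((letterCount w i : ℕ) : ℤ) ≠ ((lam.sortedParts.getD i 0 : ℕ) : ℤ) := by
    exact_mod_cast hi
  exact apply_eq_zero_of_mem_highestWeightSpace ℂ hξ hne

/-- **The `λ`-isotypic component lies in the commutant span of the words of content `λ`**: for every
finite set `L` of words containing all words of content `λ` and every vector `v`,
`P_λ v ∈ 𝒲(L)`. By the span form of Schur–Weyl duality (`range_isotypicProj_wordPermRep`: the range
of `P_λ` is spanned by the `GL_N`-translates of `HW_λ`), the support of highest-weight vectors, and
`g^{⊗n} e_w ∈ 𝒲({w})`. [cite: ChristandlVranaZuiddam2023, §3.1 (sw)] -/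
theorem wordIsotypicMatrix_mulVec_mem_commutantSpan (lam : Nat.Partition n) {L : Finset (Word N n)}
    (hL : ∀ w : Word N n, (∀ i, letterCount w i = lam.sortedParts.getD i 0) → w ∈ L)
    (v : Word N n → ℂ) :
    wordIsotypicMatrix N n lam *ᵥ v ∈ commutantSpan (Fin N) L := by
  rw [wordIsotypicMatrix_mulVec]
  have hmem : wordIsotypicProj N n lam v ∈
      LinearMap.range (isotypicProj (wordPermRep ℂ N n) (spechtCharacter ℂ lam)) := ⟨v, rfl⟩
  rw [range_isotypicProj_wordPermRep] at hmem
  refine (Submodule.span_le.2 ?_) hmem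
  rintro _ ⟨⟨g, ξ⟩, rfl⟩
  rw [SetLike.mem_coe]
  show wordRep ℂ N n g (ξ : Word N n → ℂ) ∈ commutantSpan (Fin N) L
  rw [wordRep_eq_powMat_mulVec]
  refine (IsPermInvariant.powMat _ n).mulVec_mem_commutantSpan_of_support fun w hw => ?_
  exact apply_eq_zero_of_mem_highestWeightSpace_ofPartition ξ.2 fun h => hw (hL w h)

/-- **A word of content `λ` has empirical entropy `H(λ̄)`** (`λ` with at most `N` parts; the padded
zero parts contribute `0 log 0 = 0`). [folklore] -/
theorem shannonEntropy_letterCount_eq_partitionEntropy {lam : Nat.Partition n}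
    (hN : lam.parts.card ≤ N) {w : Word N n} (hw : ∀ i, letterCount w i = lam.sortedParts.getD i 0) :
    shannonEntropy (fun i => (letterCount w i : ℝ) / n) = partitionEntropy lam := by
  rw [shannonEntropy_def, partitionEntropy_def]
  congr 1
  have hlen : lam.sortedParts.length ≤ N := by rw [Nat.Partition.length_sortedParts]; exact hN
  have h := sum_sortedParts_getD_eq lam hlen (fun m : ℕ => Real.negMulLog ((m : ℝ) / n))
  simp only [Nat.cast_zero, zero_div, Real.negMulLog_zero, mul_zero, add_zero] at h
  rw [← h]
  exact Finset.sum_congr rfl fun i _ => by rw [hw i]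

/-- **`P_λ (ℂ^N)^{⊗n} ⊆ 𝒲(L_h)` for shapes of entropy `H(λ̄) ≤ h`**, where `L_h` is the set of words
of empirical entropy `≤ h` (for `λ` with more than `N` parts `P_λ = 0`, Schur–Weyl vanishing).
[cite: ChristandlVranaZuiddam2023, §3.1 (sw)] -/
theorem wordIsotypicMatrix_mulVec_mem_commutantSpan_entropy {lam : Nat.Partition n} {h : ℝ}
    (hlam : partitionEntropy lam ≤ h) (v : Word N n → ℂ) :
    wordIsotypicMatrix N n lam *ᵥ v ∈ commutantSpan (Fin N)
      (Finset.univ.filter fun u : Word N n =>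
        shannonEntropy (fun i => (letterCount u i : ℝ) / n) ≤ h) := by
  by_cases hN : lam.parts.card ≤ N
  · refine wordIsotypicMatrix_mulVec_mem_commutantSpan lam (fun w hw => ?_) v
    refine Finset.mem_filter.2 ⟨Finset.mem_univ _, ?_⟩
    rw [shannonEntropy_letterCount_eq_partitionEntropy hN hw]
    exact hlam
  · rw [wordIsotypicMatrix_mulVec]
    have h0 : wordIsotypicProj N n lam = 0 := isotypicProj_wordPermRep_eq_zero_of_lt (not_le.1 hN)
    rw [h0, LinearMap.zero_apply]
    exact Submodule.zero_mem _

/-! ## Sums of isotypic projectors -/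

/-- A sum `Q_B = ∑_{λ ∈ B} P_λ` of isotypic projectors is Hermitian. [folklore] -/
theorem isHermitian_sum_wordIsotypicMatrix (B : Finset (Nat.Partition n)) :
    (∑ lam ∈ B, wordIsotypicMatrix N n lam).IsHermitian := by
  unfold Matrix.IsHermitian
  rw [Matrix.conjTranspose_sum]
  exact Finset.sum_congr rfl fun lam _ => conjTranspose_wordIsotypicMatrix lam

/-- Products of sums of isotypic projectors: `Q_B Q_C = Q_{B ∩ C}` (orthogonal idempotents).
[folklore] -/
theorem sum_wordIsotypicMatrix_mul_sum (B C : Finset (Nat.Partition n)) :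
    (∑ lam ∈ B, wordIsotypicMatrix N n lam) * (∑ lam ∈ C, wordIsotypicMatrix N n lam) =
      ∑ lam ∈ B ∩ C, wordIsotypicMatrix N n lam := by
  classical
  rw [Finset.sum_mul_sum]
  -- for fixed `λ ∈ B` only `μ = λ` survives
  have inner : ∀ lam ∈ B, ∑ mu ∈ C, wordIsotypicMatrix N n lam * wordIsotypicMatrix N n mu =
      if lam ∈ C then wordIsotypicMatrix N n lam else 0 := by
    intro lam _
    split_ifs with hC
    · rw [Finset.sum_eq_single_of_mem lam hC fun mu _ hne => wordIsotypicMatrix_mul_of_ne (Ne.symm hne)]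
      exact wordIsotypicMatrix_mul_self lam
    · exact Finset.sum_eq_zero fun mu hmu =>
        wordIsotypicMatrix_mul_of_ne fun h => hC (h ▸ hmu)
  rw [Finset.sum_congr rfl inner, ← Finset.sum_filter]
  rfl

/-- `Q_B² = Q_B`. [folklore] -/
theorem sum_wordIsotypicMatrix_mul_sum_self (B : Finset (Nat.Partition n)) :
    (∑ lam ∈ B, wordIsotypicMatrix N n lam) * (∑ lam ∈ B, wordIsotypicMatrix N n lam) =
      ∑ lam ∈ B, wordIsotypicMatrix N n lam := by
  rw [sum_wordIsotypicMatrix_mul_sum, Finset.inter_self]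

/-- `Q_B Q_{Bᶜ} = 0`. [folklore] -/
theorem sum_wordIsotypicMatrix_mul_sum_compl (B : Finset (Nat.Partition n)) :
    (∑ lam ∈ B, wordIsotypicMatrix N n lam) * (∑ lam ∈ Bᶜ, wordIsotypicMatrix N n lam) = 0 := by
  rw [sum_wordIsotypicMatrix_mul_sum, Finset.inter_compl, Finset.sum_empty]

/-- **Complementary sums**: `Q_B + Q_{Bᶜ} = 1` (completeness `∑_λ P_λ = 1`). [folklore] -/
theorem sum_wordIsotypicMatrix_add_sum_compl (B : Finset (Nat.Partition n)) :
    (∑ lam ∈ B, wordIsotypicMatrix N n lam) + (∑ lam ∈ Bᶜ, wordIsotypicMatrix N n lam) = 1 := by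
  rw [Finset.sum_add_sum_compl, sum_wordIsotypicMatrix]

/-- `Q_B (ℂ^N)^{⊗n} ⊆ 𝒲(L)` as soon as every `P_λ`, `λ ∈ B`, maps into `𝒲(L)`. [folklore] -/
theorem sum_wordIsotypicMatrix_mulVec_mem_commutantSpan (B : Finset (Nat.Partition n))
    {L : Finset (Word N n)}
    (hB : ∀ lam ∈ B, ∀ v : Word N n → ℂ, wordIsotypicMatrix N n lam *ᵥ v ∈ commutantSpan (Fin N) L)
    (v : Word N n → ℂ) :
    (∑ lam ∈ B, wordIsotypicMatrix N n lam) *ᵥ v ∈ commutantSpan (Fin N) L := by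
  rw [Matrix.sum_mulVec]
  exact Submodule.sum_mem _ fun lam hlam => hB lam hlam v

/-- **The low-entropy isotypic part lies in the low-entropy commutant span**: if every shape in `B`
has `H(λ̄) ≤ h`, then `Q_B (ℂ^N)^{⊗n} ⊆ 𝒲(L_h)`, `L_h` the words of empirical entropy `≤ h`.
[cite: ChristandlVranaZuiddam2023, §3.1 (sw)] -/
theorem sum_wordIsotypicMatrix_mulVec_mem_commutantSpan_entropy (B : Finset (Nat.Partition n))
    {h : ℝ} (hB : ∀ lam ∈ B, partitionEntropy lam ≤ h) (v : Word N n → ℂ) :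
    (∑ lam ∈ B, wordIsotypicMatrix N n lam) *ᵥ v ∈ commutantSpan (Fin N)
      (Finset.univ.filter fun u : Word N n =>
        shannonEntropy (fun i => (letterCount u i : ℝ) / n) ≤ h) :=
  sum_wordIsotypicMatrix_mulVec_mem_commutantSpan B
    (fun lam hlam v => wordIsotypicMatrix_mulVec_mem_commutantSpan_entropy (hB lam hlam) v) v

end Isotypic

end Literature.Computability.AlgebraicComplexity

end
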